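import Summits.BirchSwinnertonDyer.BirchSwinnertonDyer.Theorems.SmallImageMuTransferAnalyticMuZeroX9TeichSpanPackets
import Summits.BirchSwinnertonDyer.BirchSwinnertonDyer.Theorems.PrintX8VerticalStevensBridge
import Summits.BirchSwinnertonDyer.BirchSwinnertonDyer.Theorems.PrintX9EvenBranchMuZeroInputFree
import Literature.NumberTheory.EllipticCurves.PAdicLFunctionIntegralityAtTwoProofs
import HarnessLib

/-!
# Crux 19630 `SmallImageMuTransfer.AnalyticMuZeroX9` — THE DICTIONARY «CONJ B⁰ ⟹ Teichmüller-orbit non-constancy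
# ⟹ analytic μ = 0», part 3/3: `teichOrbitNonConstantAt_of_teichSpanGenAll`, PROVED (plain Theorems file)

Cell `bsd-f3-mu`, seat `p1` (gen 5), `--supports stmt-BirchSwinnertonDyer-19630` (helper; director-bsd W-61, INBOX
2026-08-27T23:45:20Z: «Stub 2 (the dictionary `TeichSpanGenAll → AnalyticMuZeroX9`, certified SOUND) STILL LANDS as a
plain Theorems file … a by-name reduction is tree knowledge, not a line» — LINE C `teichSpan-x9` itself was RELEASED
by W-61, so no stub credit is claimed; the theorem below is the text that was registered as its stub 2 at 23:28:47Z,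
skeleton 7a5ad0a1c1f02cfe, mathematics -an g5 `Sketch14.lean` / MEMO-an §14.11, certified sound by -an g8 (R2)).
Theorems only (no definition, no named fact, no `sorry`); the B⁰ vocabulary is the tree module `…TeichSpanDefs.lean`
(p586637, the skeleton's §0 VERBATIM, namespace `Summit.BirchSwinnertonDyer.BirchSwinnertonDyer.Cruxes.AnalyticMuZeroX9.TeichSpan`).

* `exists_teichOrbitSum_sub_of_teichSpanGen` — LEVEL FORM: `f` a rational normalised newform on `Γ₀(N)`, `p` odd,
  `p ∤ N`, `a_p(f) ∈ ℤ`, an Eisenstein multiple `n₀{∞,0}_f ∈ Λ_f` prime to `p`; B⁰ at `(N,p)` (`TeichSpanGen N p`) and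
  winding non-constancy mod `p` ⟹ two Teichmüller-orbit sums at some level `n ≥ 1` differ mod `p`.  Proof
  (contrapositive): all orbit sums at each level `≥ 1` mutually `≡` ⟹ (parts 1–2) `S_f(p,n,u) ≡ −[0]⁺` ⟹ Manin's
  homomorphism `γ ↦ [γ·0]⁺ − [0]⁺ = m(γ)/2` (the vertical-Stevens functional) kills mod `p` every generator of B⁰
  (packets: `Σ_g m(g)/2 = S_f(p,n,u) − (p−1)[0]⁺ ≡ 0`; finite order / trace `±2` exactly; `p`-th powers; commutators)
  ⟹ by B⁰ it kills `γ·γ^ι`, `m(γ^ι) = m(γ)` ⟹ `[b/pᵐ]⁺ ≡ [0]⁺` for all good `γ` ⟹ the winding function is constant.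
* `teichOrbitNonConstantAt_of_teichSpanGenAll` — THE DICTIONARY in curve currency (= the registered stub-2 text):
  `TeichSpanGenAll → ∀ W p, 5 ≤ p → good → E[p] irreducible → CycWindingNonConstantAt W p → TeichOrbitNonConstantAt W p`
  (per newform: `p ∤ N` by good reduction, `a_p(f) = a_p(E)`, the Eisenstein multiple from irreducibility via
  `exists_intCast_mul_modularSymbol_zero_mem not_irreducible_of_frobeniusTrace_congr_holds`).
* `muAnZeroAt_of_teichSpanGenAll`, `analyticMuZeroOnClassX9_of_teichSpanGenAll` — with AN-9 (input-free) and AN-S1: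
  B⁰ ⟹ analytic `μ = 0` at every good ordinary `p ≥ 5` with `E[p]` irreducible ⟹ 19630's definiens (Theses-free).
HONEST FRAMING: 19630 stays OPEN — the tree now knows «19630 ⟸ B⁰» with B⁰ = `TeichSpanGenAll` an OPEN conjecture
(CANDIDATES row 34, BANKED by W-61; not staffed); nothing about any curve is asserted unconditionally; beyond-print
theorem: no (a dictionary).  BSD is not proved by any of this.
References: [Manin1972] Prop. 1.4; [MazurTateTeitelbaum1986Invent] §I.4, §I.8, §I.10; [GreenbergVatsal2000] Prop. 3.7.
-/

-- the summit namespace repeats `BirchSwinnertonDyer` by design (summit = problem); linter moot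
set_option linter.dupNamespace false
set_option autoImplicit false

noncomputable section

open scoped Classical MatrixGroups ModularForm
open CongruenceSubgroup
open Literature.NumberTheory.EllipticCurves.Rank1Residual

namespace Summit.BirchSwinnertonDyer.BirchSwinnertonDyer.Cruxes.AnalyticMuZeroX9.TeichSpan

open Matrix Matrix.SpecialLinearGroup
  Literature.NumberTheory.EllipticCurves Literature.NumberTheory.EllipticCurves.ModularForms
  Summit.BirchSwinnertonDyer.BirchSwinnertonDyer.Theorems.CollapseThree
  Summit.BirchSwinnertonDyer.BirchSwinnertonDyer.Theorems.PrintX8VerticalStevens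

/-! ### §E THE DICTIONARY — level form and curve form -/

section Dictionary

variable {N : ℕ} [NeZero N] {f : CuspForm (Gamma0 N) 2} {p : ℕ} [Fact p.Prime]

/-- **The dictionary, level form.**  `f` a rational normalised newform on `Γ₀(N)`, `p` an odd prime with `p ∤ N`,
`a_p(f) = ap ∈ ℤ`, `n₀{∞,0}_f ∈ Λ_f` for some `n₀` prime to `p` (the Eisenstein multiple that makes `[·]⁺_f`
`p`-integral at the `p`-power cusps — supplied by irreducibility of `E[p]` for the newform of `E`).  IF B⁰ holds at
`(N, p)` (`TeichSpanGen N p`) AND the winding function is non-constant mod `p` (some `[a/pⁿ]⁺ − [a′/pⁿ]⁺` of norm `≥ 1`),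
THEN two Teichmüller-orbit sums at some level `n ≥ 1` differ by a rational of norm `≥ 1`.
Proof = the contrapositive in the module docstring of the registered skeleton: constancy of the orbit sums mod `p`
at every level ⟹ (orbit-summed `T_p`, §B, + `S_1 = (a_p − 2)[0]⁺`) `c_n ≡ −[0]⁺` (§C) ⟹ Manin's homomorphism
`γ ↦ [γ·0]⁺ − [0]⁺ = m(γ)/2` kills every generator of B⁰ mod `p` (packets by §D; elliptic / parabolic elements exactly;
`p`-th powers) ⟹ by B⁰ it kills `γ·γ^ι`, i.e. `2([b/pᵐ]⁺ − [0]⁺) ≡ 0` for every good `γ` ⟹ `[b/pᵐ]⁺ ≡ [0]⁺` for all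
`b, m` ⟹ the winding function is constant mod `p`.
[cite: Manin1972, Prop. 1.4] [cite: MazurTateTeitelbaum1986Invent, §I.4 (4.2), §I.10 (10.1)–(10.2)] -/
theorem exists_teichOrbitSum_sub_of_teichSpanGen (hf : IsNewform0 f) (hQ : coeffField f = ⊥) (hp2 : p ≠ 2)
    (hpN : ¬ p ∣ N) {ap : ℤ} (hap : cuspCoeff f p = ap) {n₀ : ℤ} (hpn₀ : ¬ (p : ℤ) ∣ n₀)
    (h0 : (n₀ : ℂ) * modularSymbol f 0 ∈ periodLattice f) (hB : TeichSpanGen N p)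
    (hw : ∃ (n : ℕ) (a a' : ℤ), 1 ≤ ‖((ratPlusSymbol f ((a : ℚ) / (p : ℚ) ^ n) -
      ratPlusSymbol f ((a' : ℚ) / (p : ℚ) ^ n) : ℚ) : ℚ_[p])‖) :
    ∃ n : ℕ, 1 ≤ n ∧ ∃ a a' : (ZMod (p ^ n))ˣ,
      1 ≤ ‖((teichOrbitSum f p n (a : ZMod (p ^ n)) - teichOrbitSum f p n (a' : ZMod (p ^ n)) : ℚ) :
        ℚ_[p])‖ := by
  classical
  have hp : p.Prime := Fact.out
  have hpZ : Prime (p : ℤ) := Nat.prime_iff_prime_int.mp hp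
  -- period data (Manin 1972 / the period convention `re Λ_f = ℤ·Ω⁺/2`), as in the vertical-Stevens bridge
  have hreal : ∀ n, (cuspCoeff f n).im = 0 := cuspCoeff_im_eq_zero_of_coeffField_eq_bot hQ
  have hrat : ∀ r : ℚ, (ratPlusSymbol f r : ℝ) = normalizedPlusSymbol f r :=
    fun r ↦ ratCast_ratPlusSymbol_holds hf hQ r
  have hΩpos : 0 < plusPeriod f := (plusPeriod_pos_and_realPeriods_eq isZLattice_periodLattice_holds hf hQ).1
  have hΩ : plusPeriod f ≠ 0 := hΩpos.ne'
  have hΩ2 : plusPeriod f / 2 ≠ 0 := div_ne_zero hΩ two_ne_zero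
  obtain ⟨hre, -⟩ := realPeriods_eq_zmultiples_of_plusPeriod_ne_zero f hΩ
  choose m hm using exists_re_cuspSymbol_eq f hre
  have hm_zero : ∀ γ, cuspSymbol f γ = 0 → m γ = 0 := by
    intro γ hγ
    have h := hm γ
    rw [hγ, Complex.zero_re] at h
    exact_mod_cast (mul_eq_zero.mp h.symm).resolve_right hΩ2
  have hm_mul : ∀ γ δ, m (γ * δ) = m γ + m δ := by
    intro γ δ
    have h2 : (cuspSymbol f (γ * δ)).re = (cuspSymbol f γ).re + (cuspSymbol f δ).re := by
      rw [cuspSymbol_mul_holds f γ δ, Complex.add_re]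
    rw [hm, hm, hm, ← add_mul] at h2
    exact_mod_cast mul_right_cancel₀ hΩ2 h2
  have hm_one : m 1 = 0 := hm_zero 1 (cuspSymbol_one f)
  have hm_pow : ∀ (γ : Gamma0 N) (n : ℕ), m (γ ^ n) = n * m γ := by
    intro γ n
    induction n with
    | zero => simp [hm_one]
    | succ n ih => rw [pow_succ, hm_mul, ih]; push_cast; ring
  -- Manin at `r = 0`: `[b/d]⁺ − [0]⁺ = m(γ)/2` for `γ = (a b; c d)`, `d ≠ 0`
  have hcusp : ∀ γ : Gamma0 N, dEntry γ ≠ 0 →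
      ratPlusSymbol f (((bEntry γ : ℤ) : ℚ) / ((dEntry γ : ℤ) : ℚ)) - ratPlusSymbol f 0 = (m γ : ℚ) / 2 := by
    intro γ hd
    have hd' : ((γ : SL(2, ℤ)) 1 0 : ℚ) * 0 + ((γ : SL(2, ℤ)) 1 1 : ℚ) ≠ 0 := by
      rw [mul_zero, zero_add]; exact_mod_cast hd
    have h := ratCast_ratPlusSymbol_moebius_sub f hrat hreal γ 0 hd'
    simp only [mul_zero, zero_add] at h
    rw [hm] at h
    have h' : ((ratPlusSymbol f (((bEntry γ : ℤ) : ℚ) / ((dEntry γ : ℤ) : ℚ)) - ratPlusSymbol f 0 : ℚ) : ℝ) =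
        (((m γ : ℚ) / 2 : ℚ) : ℝ) := by
      push_cast
      rw [show ((bEntry γ : ℤ) : ℚ) = ((γ : SL(2, ℤ)) 0 1 : ℚ) from rfl,
        show ((dEntry γ : ℤ) : ℚ) = ((γ : SL(2, ℤ)) 1 1 : ℚ) from rfl, h]
      field_simp
    exact_mod_cast h'
  -- integrality of the symbols at the `p`-power cusps
  have hint : ∀ (k n : ℕ), ‖((ratPlusSymbol f ((k : ℚ) / (p : ℚ) ^ n) : ℚ) : ℚ_[p])‖ ≤ 1 := by
    intro k n
    have hcop : Nat.Coprime (p ^ n) N := Nat.Coprime.pow_left n ((Nat.Prime.coprime_iff_not_dvd hp).mpr hpN)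
    have hx := coprime_den_of_coprime (N := N) hcop (k : ℤ)
    rw [Int.cast_natCast, Nat.cast_pow] at hx
    exact norm_ratPlusSymbol_le_one f hp2 hpn₀ h0 hx
  have hint0 : ‖((ratPlusSymbol f 0 : ℚ) : ℚ_[p])‖ ≤ 1 := by
    have h := hint 0 0
    rwa [Nat.cast_zero, zero_div] at h
  have hintS : ∀ (n : ℕ) (a : ZMod (p ^ n)), ‖((teichOrbitSum f p n a : ℚ) : ℚ_[p])‖ ≤ 1 :=
    norm_teichOrbitSum_le_one hint
  -- suppose, for contradiction, that all orbit sums at each level `≥ 1` are mutually congruent mod `p`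
  by_contra H
  push Not at H
  -- the constants `c_m = S(m+1, 1)` and the congruences `S(m+1, u) ≡ c_m`
  set c : ℕ → ℚ := fun k ↦ teichOrbitSum f p (k + 1) 1 with hc_def
  have hcong : ∀ (k : ℕ) (u : ZMod (p ^ (k + 1))), IsUnit u →
      ‖((teichOrbitSum f p (k + 1) u - c k : ℚ) : ℚ_[p])‖ < 1 := by
    intro k u hu
    have h := H (k + 1) (by omega) hu.unit 1
    rwa [IsUnit.unit_spec, Units.val_one] at h
  -- (A′) `a_p c_{k+1} ≡ c_k`
  have hrec : ∀ k : ℕ, ‖(((ap : ℚ) * c (k + 1) - c k : ℚ) : ℚ_[p])‖ < 1 := by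
    intro k
    have hH := intCast_mul_teichOrbitSum_succ hf hpN hap hrat hp2 (n := k + 1) (by omega) 1
    rw [map_one] at hH
    have hsum : (∑ b ∈ Finset.univ.filter (fun b : ZMod (p ^ (k + 1 + 2)) ↦
        ZMod.castHom (pow_dvd_pow p (k + 1 + 1).le_succ) (ZMod (p ^ (k + 1 + 1))) b = 1),
          teichOrbitSum f p (k + 1 + 2) b) =
        (∑ b ∈ Finset.univ.filter (fun b : ZMod (p ^ (k + 1 + 2)) ↦
          ZMod.castHom (pow_dvd_pow p (k + 1 + 1).le_succ) (ZMod (p ^ (k + 1 + 1))) b = 1),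
            (teichOrbitSum f p (k + 1 + 2) b - c (k + 2))) + (p : ℚ) * c (k + 2) := by
      rw [Finset.sum_sub_distrib, Finset.sum_const, card_filter_castHom_eq, nsmul_eq_mul]; ring
    have e : (ap : ℚ) * c (k + 1) - c k =
        (∑ b ∈ Finset.univ.filter (fun b : ZMod (p ^ (k + 1 + 2)) ↦
          ZMod.castHom (pow_dvd_pow p (k + 1 + 1).le_succ) (ZMod (p ^ (k + 1 + 1))) b = 1),
            (teichOrbitSum f p (k + 1 + 2) b - c (k + 2))) + (p : ℚ) * c (k + 2) := by
      rw [← hsum, hc_def]; simp only at hH ⊢; linear_combination hH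
    rw [e]
    push_cast
    refine padic_norm_add_lt_one (norm_sum_lt_one _ _ fun b hb ↦ ?_) (norm_natCast_mul_lt_one (hintS _ _))
    rw [Finset.mem_filter] at hb
    have := hcong (k + 2) b (isUnit_of_castHom_eq isUnit_one hb.2)
    push_cast at this
    exact this
  -- (B′) `a_p c_0 ≡ −[0]⁺`
  have hzero : ‖(((ap : ℚ) * c 0 + ratPlusSymbol f 0 : ℚ) : ℚ_[p])‖ < 1 := by
    have hH := intCast_mul_teichOrbitSum_one hf hpN hap hrat hp2 1
    have hsum : (∑ b ∈ Finset.univ.filter (fun b : ZMod (p ^ (0 + 2)) ↦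
        ZMod.castHom (pow_dvd_pow p (0 + 1).le_succ) (ZMod (p ^ (0 + 1))) b = 1),
          teichOrbitSum f p (0 + 2) b) =
        (∑ b ∈ Finset.univ.filter (fun b : ZMod (p ^ (0 + 2)) ↦
          ZMod.castHom (pow_dvd_pow p (0 + 1).le_succ) (ZMod (p ^ (0 + 1))) b = 1),
            (teichOrbitSum f p (0 + 2) b - c 1)) + (p : ℚ) * c 1 := by
      rw [Finset.sum_sub_distrib, Finset.sum_const, card_filter_castHom_eq, nsmul_eq_mul]; ring
    have hp1 : ((p - 1 : ℕ) : ℚ) = (p : ℚ) - 1 := by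
      rw [Nat.cast_sub hp.one_le, Nat.cast_one]
    have e : (ap : ℚ) * c 0 + ratPlusSymbol f 0 =
        (∑ b ∈ Finset.univ.filter (fun b : ZMod (p ^ (0 + 2)) ↦
          ZMod.castHom (pow_dvd_pow p (0 + 1).le_succ) (ZMod (p ^ (0 + 1))) b = 1),
            (teichOrbitSum f p (0 + 2) b - c 1)) + (p : ℚ) * (c 1 + ratPlusSymbol f 0) := by
      rw [hp1] at hH; rw [hc_def]; simp only at hH ⊢; linear_combination hH + hsum
    rw [e]
    push_cast
    refine padic_norm_add_lt_one (norm_sum_lt_one _ _ fun b hb ↦ ?_) (norm_natCast_mul_lt_one ?_)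
    · rw [Finset.mem_filter] at hb
      have := hcong 1 b (isUnit_of_castHom_eq isUnit_one hb.2)
      push_cast at this
      exact this
    · have := Padic.nonarchimedean ((c 1 : ℚ) : ℚ_[p]) ((ratPlusSymbol f 0 : ℚ) : ℚ_[p])
      exact this.trans (max_le (hintS _ _) hint0)
  -- (C′) `c_0 = (a_p − 2)[0]⁺`
  have hX0 : c 0 = ((ap : ℚ) - 2) * ratPlusSymbol f 0 := by
    have h := teichOrbitSum_one_eq hf hpN hap hrat hp2 1
    rw [Units.val_one] at h
    exact h
  -- §C: `c_k ≡ −[0]⁺` for every `k`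
  have hcs : ∀ k : ℕ, ‖((c k + ratPlusSymbol f 0 : ℚ) : ℚ_[p])‖ < 1 := by
    intro k
    have h := norm_add_lt_one_of_recursion (A := ((ap : ℤ) : ℚ_[p])) (s₀ := ((ratPlusSymbol f 0 : ℚ) : ℚ_[p]))
      (X := fun k ↦ ((c k : ℚ) : ℚ_[p])) (Padic.norm_int_le_one ap) (fun k ↦ hintS _ _)
      (fun k ↦ by have := hrec k; push_cast at this ⊢; exact this)
      (by have := hzero; push_cast at this ⊢; exact this)
      (by rw [hX0]; push_cast; ring) k
    push_cast
    exact h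
  -- hence every orbit sum at level `k + 1` over a unit is `≡ −[0]⁺`
  have horb : ∀ (k : ℕ) (u : ZMod (p ^ (k + 1))), IsUnit u →
      ‖((teichOrbitSum f p (k + 1) u + ratPlusSymbol f 0 : ℚ) : ℚ_[p])‖ < 1 := by
    intro k u hu
    have h := padic_norm_add_lt_one (hcong k u hu) (hcs k)
    push_cast at h ⊢
    rwa [show ((teichOrbitSum f p (k + 1) u : ℚ) : ℚ_[p]) - ((c k : ℚ) : ℚ_[p]) +
      (((c k : ℚ) : ℚ_[p]) + ((ratPlusSymbol f 0 : ℚ) : ℚ_[p])) =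
      ((teichOrbitSum f p (k + 1) u : ℚ) : ℚ_[p]) + ((ratPlusSymbol f 0 : ℚ) : ℚ_[p]) by ring] at h
  -- the reduction of `m` mod `p` as a homomorphism `Γ₀(N) → ℤ/p`
  let φ : Gamma0 N →* Multiplicative (ZMod p) :=
    { toFun := fun γ ↦ Multiplicative.ofAdd (((m γ : ℤ) : ZMod p))
      map_one' := by simp [hm_one]
      map_mul' := fun γ δ ↦ by simp [hm_mul, ofAdd_add] }
  have hφ : ∀ γ, φ γ = 1 ↔ (p : ℤ) ∣ m γ := by
    intro γ
    simp [φ, ZMod.intCast_zmod_eq_zero_iff_dvd]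
  -- every generator of B⁰ lies in the kernel
  have hker : Subgroup.closure (teichSpanGenerators N p) ⊔ commutator (Gamma0 N) ≤ φ.ker := by
    refine sup_le ?_ (Abelianization.commutator_subset_ker φ)
    rw [Subgroup.closure_le]
    rintro γ ((⟨n, l, hn, hl, rfl⟩ | hγ) | ⟨h, rfl⟩)
    · -- packet products: `Σ_g m(g)/2 = S(n,u) − (p−1)[0]⁺ ≡ 0`
      obtain ⟨k, rfl⟩ : ∃ k, n = k + 1 := ⟨n - 1, by omega⟩
      have hlnd : l.Nodup := hl.2.2.1.of_map _
      have hlen : l.length = p - 1 := hl.1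
      obtain ⟨u, hu⟩ := exists_sum_packet_eq_teichOrbitSum (f := f) hp2 hn hl
      rw [← List.sum_toFinset _ hlnd] at hu
      -- `(Σ_g m g)/2 = S(k+1, u) − (p − 1)[0]⁺`
      have hmsum : ((((l.map m).sum : ℤ) : ℚ) / 2 : ℚ) =
          teichOrbitSum f p (k + 1) (u : ZMod (p ^ (k + 1))) - ((p - 1 : ℕ) : ℚ) * ratPlusSymbol f 0 := by
        rw [← hu, Int.cast_list_sum, List.map_map, ← List.sum_toFinset _ hlnd, Finset.sum_div,
          ← hlen, ← List.toFinset_card_of_nodup hlnd]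
        rw [show ((l.toFinset.card : ℕ) : ℚ) * ratPlusSymbol f 0 = ∑ g ∈ l.toFinset, ratPlusSymbol f 0 by
          rw [Finset.sum_const, nsmul_eq_mul], ← Finset.sum_sub_distrib]
        refine Finset.sum_congr rfl fun g hg ↦ ?_
        rw [List.mem_toFinset] at hg
        have hd := dEntry_eq_of_isTeichPacket hl hg
        have hd0 : dEntry g ≠ 0 := by rw [hd]; exact pow_ne_zero _ (by exact_mod_cast hp.ne_zero)
        rw [Function.comp_apply, ← hcusp g hd0, hd]
        push_cast
        rfl
      -- hence `p ∣ Σ_g m g`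
      have hdvd : (p : ℤ) ∣ (l.map m).sum := by
        apply dvd_of_norm_div_two_lt_one hp2
        rw [hmsum, show teichOrbitSum f p (k + 1) (u : ZMod (p ^ (k + 1))) - ((p - 1 : ℕ) : ℚ) * ratPlusSymbol f 0
          = (teichOrbitSum f p (k + 1) (u : ZMod (p ^ (k + 1))) + ratPlusSymbol f 0) - (p : ℚ) * ratPlusSymbol f 0
          by rw [Nat.cast_sub hp.one_le, Nat.cast_one]; ring]
        push_cast
        have h1 := horb k (u : ZMod (p ^ (k + 1))) u.isUnit
        push_cast at h1
        exact norm_sub_lt_one h1 (norm_natCast_mul_lt_one hint0)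
      -- and the product of the `φ g` is `ofAdd (Σ m g mod p) = 1`
      have hlist : l.map φ = (l.map fun g ↦ ((m g : ℤ) : ZMod p)).map Multiplicative.ofAdd := by
        rw [List.map_map]; rfl
      have hcast : (l.map fun g ↦ ((m g : ℤ) : ZMod p)).sum = (((l.map m).sum : ℤ) : ZMod p) := by
        rw [Int.cast_list_sum, List.map_map]; rfl
      rw [SetLike.mem_coe, MonoidHom.mem_ker, φ.map_list_prod, hlist, ← ofAdd_list_prod, ofAdd_eq_one, hcast,
        ZMod.intCast_zmod_eq_zero_iff_dvd]
      exact hdvd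
    · rw [SetLike.mem_coe, MonoidHom.mem_ker, hφ]
      rcases hγ with hfin | htr
      · exact ⟨0, by rw [hm_zero γ (cuspSymbol_eq_zero_of_isOfFinOrder f hfin), mul_zero]⟩
      · exact ⟨0, by rw [hm_zero γ (cuspSymbol_eq_zero_of_trEntry f htr), mul_zero]⟩
    · -- `p`-th powers
      rw [SetLike.mem_coe, MonoidHom.mem_ker, hφ, hm_pow]
      exact ⟨m h, by ring⟩
  -- B⁰: for every good `γ`, `γ·γ^ι ∈ ker φ`, i.e. `p ∣ m γ + m(ιγ) = 2 m γ`, so `[b/d]⁺ ≡ [0]⁺`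
  have hp2Z : ¬ (p : ℤ) ∣ 2 := fun h ↦
    hp2 ((Nat.prime_dvd_prime_iff_eq hp Nat.prime_two).mp (by exact_mod_cast h))
  have hgood : ∀ γ : Gamma0 N, IsGoodAt p γ →
      ‖((ratPlusSymbol f (((bEntry γ : ℤ) : ℚ) / ((dEntry γ : ℤ) : ℚ)) - ratPlusSymbol f 0 : ℚ) : ℚ_[p])‖ < 1 := by
    intro γ hγ
    obtain ⟨e, he⟩ := hγ
    have hd0 : dEntry γ ≠ 0 := by
      intro h; rw [h, Int.natAbs_zero] at he; exact pow_ne_zero e hp.ne_zero he.symm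
    have hι : m (iotaGamma0 γ) = m γ := by
      have h1 := hcusp (iotaGamma0 γ) (by rwa [dEntry_iotaGamma0])
      rw [bEntry_iotaGamma0, dEntry_iotaGamma0, Int.cast_neg, neg_div, ratPlusSymbol_neg f, hcusp γ hd0] at h1
      have h2 : (m (iotaGamma0 γ) : ℚ) = m γ := by linarith
      exact_mod_cast h2
    have h2 : (p : ℤ) ∣ m (γ * iotaGamma0 γ) := (hφ _).mp (hker (hB γ ⟨e, he⟩))
    rw [hm_mul, hι, ← two_mul] at h2
    have hdvd : (p : ℤ) ∣ m γ := (hpZ.dvd_or_dvd h2).resolve_left hp2Z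
    rw [hcusp γ hd0]
    exact norm_div_two_lt_one_of_dvd hp2 hdvd
  -- every `p`-power cusp: `[b/p^k]⁺ ≡ [0]⁺` (induction on `k`; `p ∣ b` lowers the level, `p ∤ b` is a good `γ`)
  have hpNZ : ¬ (p : ℤ) ∣ (N : ℤ) := fun h ↦ hpN (by exact_mod_cast h)
  have hall : ∀ (k : ℕ) (b : ℤ),
      ‖((ratPlusSymbol f ((b : ℚ) / (p : ℚ) ^ k) - ratPlusSymbol f 0 : ℚ) : ℚ_[p])‖ < 1 := by
    intro k
    induction k with
    | zero =>
      intro b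
      rw [pow_zero, div_one, show (b : ℚ) = 0 + ((b : ℤ) : ℚ) by simp, ratPlusSymbol_add_intCast_eq, sub_self,
        Rat.cast_zero, norm_zero]
      exact zero_lt_one
    | succ k ih =>
      intro b
      by_cases hpb : (p : ℤ) ∣ b
      · obtain ⟨b', rfl⟩ := hpb
        have hpQ : (p : ℚ) ≠ 0 := Nat.cast_ne_zero.mpr hp.ne_zero
        have e : (((p : ℤ) * b' : ℤ) : ℚ) / (p : ℚ) ^ (k + 1) = (b' : ℚ) / (p : ℚ) ^ k := by
          push_cast; rw [pow_succ]; field_simp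
        rw [e]; exact ih b'
      · have hcop : IsCoprime ((p : ℤ) ^ (k + 1)) (b * N) :=
          IsCoprime.pow_left (IsCoprime.mul_right ((Prime.coprime_iff_not_dvd hpZ).mpr hpb)
            ((Prime.coprime_iff_not_dvd hpZ).mpr hpNZ))
        obtain ⟨x, y, hxy⟩ := hcop
        have hdet : Matrix.det !![x, b; -(y * N), (p : ℤ) ^ (k + 1)] = 1 := by
          rw [Matrix.det_fin_two_of]; linear_combination hxy
        have hw0 : (((-(y * (N : ℤ)) : ℤ)) : ZMod N) = 0 := by push_cast; rw [ZMod.natCast_self]; ring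
        have hmemN : (⟨!![x, b; -(y * N), (p : ℤ) ^ (k + 1)], hdet⟩ : SL(2, ℤ)) ∈ Gamma0 N :=
          Gamma0_mem.mpr (by simp [hw0])
        set γ₁ : Gamma0 N := ⟨⟨!![x, b; -(y * N), (p : ℤ) ^ (k + 1)], hdet⟩, hmemN⟩ with hγ₁
        have hb : bEntry γ₁ = b := rfl
        have hd : dEntry γ₁ = (p : ℤ) ^ (k + 1) := rfl
        have hγgood : IsGoodAt p γ₁ := ⟨k + 1, by rw [hd, Int.natAbs_pow, Int.natAbs_natCast]⟩
        have h := hgood γ₁ hγgood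
        rw [hb, hd] at h
        push_cast at h
        exact h
  -- contradiction with the non-constancy of the winding function
  obtain ⟨n, a, a', hw⟩ := hw
  have h := norm_sub_lt_one (hall n a) (hall n a')
  rw [← Rat.cast_sub, show ratPlusSymbol f ((a : ℚ) / (p : ℚ) ^ n) - ratPlusSymbol f 0 -
      (ratPlusSymbol f ((a' : ℚ) / (p : ℚ) ^ n) - ratPlusSymbol f 0) =
      ratPlusSymbol f ((a : ℚ) / (p : ℚ) ^ n) - ratPlusSymbol f ((a' : ℚ) / (p : ℚ) ^ n) by ring] at h
  exact absurd hw (not_le.mpr h)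

/-- **THE DICTIONARY in curve currency** (the text registered 2026-08-27T23:28:47Z as stub 2 of the released LINE C
`teichSpan-x9`, skeleton 7a5ad0a1c1f02cfe, -imc g9 / -an g5; landed as a plain theorem per director-bsd W-61).  Granted CONJ
B⁰ at every level prime to `p` (`TeichSpanGenAll`), for `E = W/ℚ`, `p ≥ 5` of good reduction with `E[p]` irreducible:
winding non-constancy
mod `p` (`CycWindingNonConstantAt W p` — itself an input-free tree theorem, AN-9
`EvenBranch.cycWindingNonConstantAt_of_odd`) implies Teichmüller-orbit non-constancy
(`TeichOrbitNonConstantAt W p`, ⟺ `μ^an(E,p) = 0` at good ordinary `p` by the tree's `an_s1/an_s2`).  Per newform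
`f` of `E` (`p ∤ N` by good reduction; `a_p(f) = a_p(E)`; the Eisenstein multiple `n₀{∞,0} ∈ Λ_f` prime to `p` from
irreducibility, `exists_intCast_mul_modularSymbol_zero_mem` + `not_irreducible_of_frobeniusTrace_congr_holds`) this
is the level form `exists_teichOrbitSum_sub_of_teichSpanGen`.  No ordinarity and no image hypothesis beyond
irreducibility; `5 ≤ p` is used only as `p ≠ 2`.
[cite: Manin1972, Prop. 1.4] [cite: MazurTateTeitelbaum1986Invent, §I.10 (10.1)–(10.2)] [cite: GreenbergVatsal2000, Prop. 3.7] -/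
theorem teichOrbitNonConstantAt_of_teichSpanGenAll :
    TeichSpanGenAll →
      ∀ (W : WeierstrassCurve ℚ) [W.IsElliptic] [W.IsGloballyMinimal] (p : ℕ) [Fact p.Prime],
        5 ≤ p → W.HasGoodReductionAtPrime p → W.HasIrreducibleModPGaloisRep p →
          CycWindingNonConstantAt W p → TeichOrbitNonConstantAt W p := by
  intro hB W _ _ p _ hp5 hgood hirr hcyc N _ f hf
  have hp : p.Prime := Fact.out
  have hp2 : p ≠ 2 := by omega
  have hpN : ¬ p ∣ N := not_dvd_level_of_isNewformOf hf hgood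
  obtain ⟨n₀, hpn₀, h0⟩ :=
    exists_intCast_mul_modularSymbol_zero_mem not_irreducible_of_frobeniusTrace_congr_holds hf hirr
  exact exists_teichOrbitSum_sub_of_teichSpanGen hf.1 hf.coeffField_eq_bot hp2 hpN
    (cuspCoeff_eq_frobeniusTrace_of_isNewformOf_holds hf hgood) hpn₀ h0 (hB N p hp hp5 hpN) (hcyc f hf)

/-- **Greenberg's analytic `μ = 0` at every good ordinary `p ≥ 5` with `E[p]` irreducible, MODULO CONJ B⁰** (all
images): `TeichSpanGenAll →` for every `E = W/ℚ`, `p ≥ 5` good ordinary, `E[p]`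
irreducible, `MuAnZeroAt W p` (some coefficient of `L_p(f, α_E)` is a unit for every newform `f` of `E`).
AN-9 (input-free) ⟹ the dictionary ⟹ AN-S1 (`muAnZeroAt_of_teichOrbitNonConstantAt`).  CONDITIONAL on the open conjecture
B⁰ (displayed as the hypothesis); nothing about any curve is asserted unconditionally.
[cite: GreenbergLNM1716, §1 Conj. 1.11] [cite: MazurTateTeitelbaum1986Invent, §I.10–I.13] -/
theorem muAnZeroAt_of_teichSpanGenAll (hB : TeichSpanGenAll) (W : WeierstrassCurve ℚ) [W.IsElliptic]
    [W.IsGloballyMinimal] (p : ℕ) [Fact p.Prime] (hp5 : 5 ≤ p) (hord : IsOrdinaryAt W p)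
    (hirr : W.HasIrreducibleModPGaloisRep p) : MuAnZeroAt W p :=
  muAnZeroAt_of_teichOrbitNonConstantAt (by omega) hord hirr
    (teichOrbitNonConstantAt_of_teichSpanGenAll hB W p hp5 hord.1 hirr
      (Summit.BirchSwinnertonDyer.BirchSwinnertonDyer.Rank1Residual.EvenBranch.cycWindingNonConstantAt_of_odd
        W p (by omega) hord.1 hirr))

/-- **Item 19630 in its Theses-free currency, MODULO CONJ B⁰**: `TeichSpanGenAll →
Rank1Residual.AnalyticMuZeroOnClassX9` (the definiens of `Theses.SmallImageMuTransfer.AnalyticMuZeroX9` and of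
`Theses.PrintX9.AnalyticMuZeroX9`): on class X9 (`p ≥ 5` good ordinary, `E[p]` irreducible, image not surjective,
no CM) every newform has a unit coefficient in `L_p(f, α_E)` — the former skeleton's composition
`TeichSpan.AnalyticMuZeroX9_of` with the dictionary discharged and B⁰ displayed as the hypothesis `hB`;
non-surjectivity and `¬CM` are not used.
[cite: GreenbergLNM1716, §1 Conj. 1.11] [cite: MazurTateTeitelbaum1986Invent, §I.10–I.13] -/
theorem analyticMuZeroOnClassX9_of_teichSpanGenAll (hB : TeichSpanGenAll) :
    Summit.BirchSwinnertonDyer.BirchSwinnertonDyer.Rank1Residual.AnalyticMuZeroOnClassX9 := by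
  intro W _ _ p _ N _ f hX9 hf
  obtain ⟨-, hp, hgood, hap, hirr, -⟩ := id hX9
  exact muAnZeroAt_of_teichSpanGenAll hB W p hp ⟨hgood, hap⟩ hirr f hf

end Dictionary

end Summit.BirchSwinnertonDyer.BirchSwinnertonDyer.Cruxes.AnalyticMuZeroX9.TeichSpan

end
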